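import Mathlib
import Literature.LinearAlgebra.Matrix.SymmetricDetMod2

/-!
# Bordered determinants of symmetric matrices over `𝔽₂`: `det [[N, c],[cᵀ, 0]] = Σ_β c_β adj(N)_{ββ}`, double borders, congruence

Companion of `Literature/LinearAlgebra/Matrix/SymmetricDetMod2.lean` (peeling a vertex of a symmetric matrix over
`𝔽₂`).  For the bordered block matrices of A. Smith's Table 2 [Smith2016CongruentDensity, Thm. 2.2 rows 3, 5(a), 5(b),
6: `[[M, u],[uᵀ, 0]]`; rows 7(a), 7(b): `[[M, u, v],[uᵀ, 0, 0],[vᵀ, 0, 0]]`], written with Mathlib's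
`fromBlocks M (replicateCol Unit c) (replicateRow Unit c) 0` on `n ⊕ Unit` (and iterated once more for two borders):
* `det_fromBlocks_border` — for symmetric `N` over `𝔽₂`: `det [[N, c],[cᵀ, 0]] = Σ_β c_β · adj(N)_{ββ}`
  (Laplace along the border row and column; the off-diagonal two-sided cofactors cancel in pairs);
* `unitize_fromBlocks_border_inl` — deleting an inner index `α` of a bordered matrix gives the bordered matrix of
  `unitize N α` with the border entry `c_α` zeroed;
* `det_fromBlocks_border_border` — the DOUBLE border: `det [[N, b, b′],[bᵀ, 0, 0],[b′ᵀ, 0, 0]] =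
  Σ_α b′_α Σ_β [β ≠ α] b_β · det N^{(αβ)}` (`N^{(αβ)} = unitize (unitize N α) β`: `N` with rows and columns `α, β`
  unitized);
* `fromBlocks_border_conj`, `det_fromBlocks_border_conj` — congruence by `[[P, 0],[0, 1]]` transports a border `c`
  to `P c` (so over `𝔽₂`, `det [[P M Pᵀ, P c],[(P c)ᵀ, 0]] = det [[M, c],[cᵀ, 0]]` when `det P = 1`).
-/

namespace Literature.LinearAlgebra.Matrix

open _root_.Matrix Finset

variable {n : Type*} [Fintype n] [DecidableEq n]

section Conj

variable {R : Type*} [CommRing R]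

omit [DecidableEq n] in
/-- **Congruence transports the border**: `[[P, 0],[0, 1]] · [[M, c],[cᵀ, 0]] · [[P, 0],[0, 1]]ᵀ =
[[P M Pᵀ, P c],[(P c)ᵀ, 0]]`. [cite: HornJohnson2013, §0.7.3 (block matrix products)] -/
theorem fromBlocks_border_conj (P M : Matrix n n R) (c : n → R) :
    fromBlocks P 0 0 (1 : Matrix Unit Unit R) * fromBlocks M (replicateCol Unit c) (replicateRow Unit c) 0 *
        (fromBlocks P 0 0 (1 : Matrix Unit Unit R))ᵀ =
      fromBlocks (P * M * Pᵀ) (replicateCol Unit (P *ᵥ c)) (replicateRow Unit (P *ᵥ c)) 0 := by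
  have hB : P * replicateCol Unit c = replicateCol Unit (P *ᵥ c) := by
    ext i u; simp [Matrix.mul_apply, mulVec, dotProduct]
  have hC : replicateRow Unit c * Pᵀ = replicateRow Unit (P *ᵥ c) := by
    ext u j; simp [Matrix.mul_apply, mulVec, dotProduct, mul_comm]
  rw [fromBlocks_transpose, transpose_zero, transpose_zero, transpose_one, fromBlocks_multiply, fromBlocks_multiply]
  simp only [Matrix.zero_mul, Matrix.mul_zero, add_zero, zero_add, Matrix.one_mul, Matrix.mul_one]
  rw [hB, hC]

/-- The determinant form of the transport: `det [[P M Pᵀ, P c],[(P c)ᵀ, 0]] = det P · det P · det [[M, c],[cᵀ, 0]]`.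
[cite: HornJohnson2013, §0.8.5 (determinant of a product)] -/
theorem det_fromBlocks_border_conj (P M : Matrix n n R) (c : n → R) :
    (fromBlocks (P * M * Pᵀ) (replicateCol Unit (P *ᵥ c)) (replicateRow Unit (P *ᵥ c)) 0).det =
      P.det * P.det * (fromBlocks M (replicateCol Unit c) (replicateRow Unit c) 0).det := by
  rw [← fromBlocks_border_conj, det_mul, det_mul, det_transpose, det_fromBlocks_zero₂₁, det_one, mul_one]
  ring

omit [Fintype n] in
/-- **Deleting an inner index of a bordered matrix**: for `α : n`,
`unitize [[N, c],[cᵀ, 0]] (inl α) = [[unitize N α, c′],[c′ᵀ, 0]]` with `c′ = c` except `c′_α = 0`.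
[cite: Smith2016CongruentDensity, §2.2 (the bordered matrices O(A, z, u)[S])] -/
theorem unitize_fromBlocks_border_inl (N : Matrix n n R) (c : n → R) (α : n) :
    unitize (fromBlocks N (replicateCol Unit c) (replicateRow Unit c) 0) (Sum.inl α) =
      fromBlocks (unitize N α) (replicateCol Unit (Function.update c α 0))
        (replicateRow Unit (Function.update c α 0)) 0 := by
  ext (i | i) (j | j)
  · rw [unitize_apply, fromBlocks_apply₁₁, fromBlocks_apply₁₁, unitize_apply]
    by_cases hj : j = α
    · subst hj
      rw [if_pos rfl, if_pos rfl]
      by_cases hi : i = j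
      · subst hi; rw [if_pos rfl, if_pos rfl]
      · rw [if_neg (fun h => hi (Sum.inl_injective h)), if_neg hi]
    · rw [if_neg (fun h => hj (Sum.inl_injective h)), if_neg hj]
      by_cases hi : i = α
      · subst hi; rw [if_pos rfl, if_pos rfl]
      · rw [if_neg (fun h => hi (Sum.inl_injective h)), if_neg hi]
  · rw [unitize_apply, if_neg Sum.inr_ne_inl, fromBlocks_apply₁₂, fromBlocks_apply₁₂, replicateCol_apply,
      replicateCol_apply]
    by_cases hi : i = α
    · subst hi; rw [if_pos rfl, Function.update_self]
    · rw [if_neg (fun h => hi (Sum.inl_injective h)), Function.update_of_ne hi]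
  · rw [unitize_apply, fromBlocks_apply₂₁, fromBlocks_apply₂₁, replicateRow_apply, replicateRow_apply]
    by_cases hj : j = α
    · subst hj; rw [if_pos rfl, if_neg Sum.inr_ne_inl, Function.update_self]
    · rw [if_neg (fun h => hj (Sum.inl_injective h)), if_neg Sum.inr_ne_inl, Function.update_of_ne hj]
  · rw [unitize_apply, if_neg Sum.inr_ne_inl, if_neg Sum.inr_ne_inl, fromBlocks_apply₂₂, fromBlocks_apply₂₂]

omit [Fintype n] in
/-- Deleting the border index itself: `unitize [[N, c],[cᵀ, 0]] (inr ()) = [[N, 0],[0, 1]]`.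
[cite: Smith2016CongruentDensity, §2.2] -/
theorem unitize_fromBlocks_border_inr (N : Matrix n n R) (c : n → R) :
    unitize (fromBlocks N (replicateCol Unit c) (replicateRow Unit c) 0) (Sum.inr ()) =
      fromBlocks N 0 0 (1 : Matrix Unit Unit R) := by
  ext (i | i) (j | j)
  · rw [unitize_apply, if_neg Sum.inl_ne_inr, if_neg Sum.inl_ne_inr, fromBlocks_apply₁₁, fromBlocks_apply₁₁]
  · rw [unitize_apply, if_pos (by cases j; rfl), if_neg Sum.inl_ne_inr, fromBlocks_apply₁₂, Matrix.zero_apply]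
  · rw [unitize_apply, if_neg Sum.inl_ne_inr, if_pos (by cases i; rfl), fromBlocks_apply₂₁, Matrix.zero_apply]
  · rw [unitize_apply, if_pos (by cases j; rfl), if_pos (by cases i; rfl), fromBlocks_apply₂₂, Matrix.one_apply,
      if_pos (by cases i; cases j; rfl)]

end Conj

section ZModTwo

/-- **The bordered determinant of a symmetric matrix over `𝔽₂`**:
`det [[N, c],[cᵀ, 0]] = Σ_β c_β · adj(N)_{ββ}` (`= cᵀ adj(N) c`; the two-sided cofactors `c_α c_β C(α, β)`, `α ≠ β`,
cancel in pairs by symmetry). [cite: Smith2016CongruentDensity, §2.2 (source cnc2.tex l. 30–36: |A+Aᵀ, Aᵀ, u; A, D_z, 0; uᵀ, 0, 0| expanded)] [cite: HornJohnson2013, §0.8.2 (cofactor expansion)] -/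
theorem det_fromBlocks_border {N : Matrix n n (ZMod 2)} (hN : Nᵀ = N) (c : n → ZMod 2) :
    (fromBlocks N (replicateCol Unit c) (replicateRow Unit c) 0).det = ∑ β, c β * N.adjugate β β := by
  set M := fromBlocks N (replicateCol Unit c) (replicateRow Unit c) (0 : Matrix Unit Unit (ZMod 2)) with hM
  have hsymm : Mᵀ = M := by
    rw [hM, fromBlocks_transpose, hN, transpose_replicateCol, transpose_replicateRow, transpose_zero]
  have hrow : ∀ J, J ≠ Sum.inr () → M (Sum.inr ()) J =
      ∑ β ∈ (univ : Finset n), c β * (Pi.single (Sum.inl β) (1 : ZMod 2) : n ⊕ Unit → ZMod 2) J := by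
    intro J hJ
    rcases J with b | u
    · rw [hM, fromBlocks_apply₂₁, replicateRow_apply, Finset.sum_eq_single b]
      · simp
      · intro β _ hβ; simp [hβ]
      · intro h; exact absurd (mem_univ b) h
    · exact absurd (by cases u; rfl) hJ
  rw [det_eq_peel_of_decomp hsymm (Sum.inr ()) univ c (fun β => Pi.single (Sum.inl β) 1) (fun β _ => by simp) hrow,
    hM, fromBlocks_apply₂₂, Matrix.zero_apply, zero_mul, zero_add]
  refine Finset.sum_congr rfl fun β _ => ?_
  rw [det_border_single _ (Sum.inl_ne_inr : (Sum.inl β : n ⊕ Unit) ≠ Sum.inr ()),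
    ← det_unitize_unitize _ (Sum.inl_ne_inr : (Sum.inl β : n ⊕ Unit) ≠ Sum.inr ()),
    unitize_fromBlocks_border_inl, unitize_fromBlocks_border_inr, det_fromBlocks_zero₂₁, det_one, mul_one,
    det_unitize, ← adjugate_apply]

/-- The diagonal cofactor is the determinant of the unitized matrix. [cite: HornJohnson2013, §0.8.2] -/
theorem adjugate_apply_self_eq_det_unitize {R : Type*} [CommRing R] (N : Matrix n n R) (β : n) :
    N.adjugate β β = (unitize N β).det := by
  rw [det_unitize, adjugate_apply]

/-- **The doubly bordered determinant of a symmetric matrix over `𝔽₂`**: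
`det [[N, b, b′],[bᵀ, 0, 0],[b′ᵀ, 0, 0]] = Σ_α b′_α · Σ_β [β ≠ α] b_β · det (unitize (unitize N α) β)`
(the Laplace expansion along the two border columns: only the `2 × 2` minors `b′_α b_β + b′_β b_α` of the border
paired with the complementary principal minors of `N` survive; written here as the ordered double sum).
The doubly bordered matrix is the bordered matrix of `[[N, b],[bᵀ, 0]]` by `(b′; 0)`.
[cite: Smith2016CongruentDensity, §2.2 (source cnc2.tex l. 36–52: the doubly bordered determinants of rows 7(a), 7(b))] [cite: HornJohnson2013, §0.8.9 (Laplace expansion)] -/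
theorem det_fromBlocks_border_border {N : Matrix n n (ZMod 2)} (hN : Nᵀ = N) (b b' : n → ZMod 2) :
    (fromBlocks (fromBlocks N (replicateCol Unit b) (replicateRow Unit b) 0)
        (replicateCol Unit (Sum.elim b' 0)) (replicateRow Unit (Sum.elim b' 0)) 0).det =
      ∑ α, b' α * ∑ β, (if β = α then 0 else b β) * (unitize (unitize N α) β).det := by
  have hsymm : (fromBlocks N (replicateCol Unit b) (replicateRow Unit b) (0 : Matrix Unit Unit (ZMod 2)))ᵀ =
      fromBlocks N (replicateCol Unit b) (replicateRow Unit b) 0 := by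
    rw [fromBlocks_transpose, hN, transpose_replicateCol, transpose_replicateRow, transpose_zero]
  rw [det_fromBlocks_border hsymm, Fintype.sum_sum_type]
  simp only [Sum.elim_inl, Sum.elim_inr, Pi.zero_apply, zero_mul, Finset.sum_const_zero, add_zero]
  refine Finset.sum_congr rfl fun α _ => ?_
  congr 1
  rw [adjugate_apply_self_eq_det_unitize, unitize_fromBlocks_border_inl,
    det_fromBlocks_border (by rw [unitize_transpose, hN]) (Function.update b α 0)]
  refine Finset.sum_congr rfl fun β _ => ?_
  rw [adjugate_apply_self_eq_det_unitize]
  by_cases h : β = α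
  · rw [h, Function.update_self, if_pos rfl]
  · rw [Function.update_of_ne h, if_neg h]

end ZModTwo

end Literature.LinearAlgebra.Matrix
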